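import Summits.HodgeConjecture.HodgeConjecture.Theorems.F0P3cStCharTSStPin              -- ★ p851514 (this seat) S4 FILE E «ST-PIN★» `exists_scalarCenter`, `exists_stDetFields`
import Summits.HodgeConjecture.HodgeConjecture.Theorems.F0P3cStCharTSTorusCompactPart    -- ★ `compactSpace_normOneUnits` (`E¹_v` compact at a non-split `v`)
import Summits.HodgeConjecture.HodgeConjecture.Theorems.F0P3cStCharTSPs2Kind3            -- ★ `isConstituentOf_iff_weyl` (★ K1w, the `w`-twin)
import Literature.NumberTheory.Automorphic.LocalUnitaryGroupCenter                       -- ★ `forall_mem_center_cmLocal_eq_scalar` (central ⇒ scalar)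
import Literature.NumberTheory.Automorphic.LocalUnitaryGroupCongr                        -- ★ `antidiagOne_isHermitian`, `isUnit_antidiagOne_det`
import Literature.NumberTheory.Automorphic.UnitaryGroupBorelPair                         -- ★ `glDiagonal_mem_unitaryGroupOfForm_antidiagonal_iff`
import Mathlib.Topology.Homeomorph.Lemmas
import HarnessLib

/-!
# F0 · P3c · line LH6 «StCharTS» — «ST-JH★»: READING THE JORDAN–HÖLDER CLAUSE OF «ST-PIN★» AT A CHARACTER `ψ₀` OF `E¹_v`
# («`JH(i_G(χ_St(ψ₀))) = {St_G(ψ), ψ∘det_G}` with `ψ∘ι = ψ₀`», [Rogawski1990, §12.2 (1)]; datum road, case (1) of «RED-JH ⟸ KEYS-RED»)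

Cell `pub/hodgecm-mathlib`, crux H413 = `stmt-HodgeConjecture-24833` (lane `--supports … --as helper`), route HCCMUnconditional; seat F0P2-p06 (g17), on the
13:07:06Z offer of LH6-p03 (g4).  THEOREMS ONLY (no definition ∕ instance ∕ notation ∕ named fact ∕ `sorry`); ★-only imports.

WHAT.  ★ «ST-PIN★» `F0P3cStCharTSStPin.exists_stDetFields` produces the fields `stG detG : (Z(G) →* ℂˣ) → IrrClass G` of the §12.5 datum together with a
continuous scalar embedding `ι : E¹_v →* Z(G)` pinned by `ι z = z·1`, and states the Jordan–Hölder clause of `i_G(χ_St(ψ∘ι))` for every continuous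
`ψ : Z(G) →* ℂˣ`.  Consumers on the case-(1) side of «RED-JH» hold instead a continuous character `ψ₀` of `E¹_v` and the principal series `i_G(χ_St(ψ₀))`.
This file INVERTS the pin: any continuous `ι` with `ι z = z·1` is a continuous BIJECTION `E¹_v → Z(U(Φ₃)(L⁺_v))` (injective by the `(0,0)` entry; surjective
because the centre is scalar, ★ `forall_mem_center_cmLocal_eq_scalar`, and a unitary scalar has `σ`-norm one, ★ `glDiagonal_mem_unitaryGroupOfForm_antidiagonal_iff`),
hence — `E¹_v` being compact (★ `compactSpace_normOneUnits`) and `Z(G)` Hausdorff — a homeomorphism; so every continuous `ψ₀` is `ψ ∘ ι` for a (unique)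
continuous `ψ` (`exists_centerChar_comp_eq`, `centerChar_comp_eq_unique`), and the JH clause of ★ E reads at `ψ₀` (`stJH_of_fields`, its `w`-twin
`stJH_weyl_of_fields` by ★ K1w, and the packaged edition `exists_stDetFields_jh` = ★ `exists_stDetFields` with the inversion conjunct added).
HONEST LABEL: HC_CM is proved only modulo the 7 printed citations (2 remaining named inputs: hLiu418 = `stmt-HodgeConjecture-24832`, h413 =
`stmt-HodgeConjecture-24833`) until rung 0 closes; this file closes no organ (count-neutral glue for the witness ∕ rung-0 skeleton).

## References
* [Rogawski1990] J. D. Rogawski, *Automorphic Representations of Unitary Groups in Three Variables*, Ann. of Math. Stud. 123 (1990): §4.9 p. 54 (`Z ≅ E¹`),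
  §12.1 p. 172, §12.2 (1) pp. 172–173.
* [Mok2014] C. P. Mok, *Endoscopic classification of representations of quasi-split unitary groups*, Mem. AMS 235 (2015), §1 Notation p. 5 (centre `= U(1)`).
* [PlatonovRapinchuk1994] V. Platonov, A. Rapinchuk, *Algebraic Groups and Number Theory*, Academic Press (1994), §5.1 (anisotropic tori over local fields are compact).
* [Keys1984] D. Keys, *Principal series representations of special unitary groups over local fields*, Compositio Math. 51 (1984), §7 Theorem.
-/

set_option autoImplicit false

set_option linter.dupNamespace false

noncomputable section

open NumberField IsDedekindDomain MeasureTheory Topology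
open scoped Matrix MatrixGroups NNReal
open Literature.NumberTheory.Rogawski1990 Literature.NumberTheory.Automorphic Literature.NumberTheory.Automorphic.UnitaryGroup
open Literature.NumberTheory.Rogawski1990.Ch12Sec5

namespace Summit.HodgeConjecture.HodgeConjecture.Cruxes.H413.F0P3cStCharTSStJH

variable (L : Type) [Field L] [NumberField L] [IsCMField L] (v : HeightOneSpectrum (𝓞 ↥(maximalRealSubfield L)))

/-! ## §1 Inverting the pin `ι z = z·1`: `ι : E¹_v → Z(U(Φ₃)(L⁺_v))` is a homeomorphic isomorphism -/

/-- A hom `ι : E¹_v →* Z(G)` with `ι z = z·1` is injective (read the `(0,0)` entry). [cite: Rogawski1990, §4.9 p. 54] [cite: Mok2014, §1 Notation p. 5] -/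
theorem injective_of_pin (ι : ↥(normOneUnits (conjLocal L (IsCMField.complexConj L) v)) →* ↥(Subgroup.center (Gqs L v)))
    (hι : ∀ z : ↥(normOneUnits (conjLocal L (IsCMField.complexConj L) v)),
      ((ι z).val.val.val : Matrix (Fin 3) (Fin 3) (LocalRing L v)) = (((z : (LocalRing L v)ˣ) : LocalRing L v)) • (1 : Matrix (Fin 3) (Fin 3) (LocalRing L v))) :
    Function.Injective ι := by
  intro z₁ z₂ h
  have h00 := congrArg (fun c : ↥(Subgroup.center (Gqs L v)) => ((c.val.val.val : Matrix (Fin 3) (Fin 3) (LocalRing L v)) 0 0)) h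
  simp only [hι, Matrix.smul_apply, Matrix.one_apply_eq, smul_eq_mul, mul_one] at h00
  exact Subtype.ext (Units.ext h00)

/-- **A unitary scalar has `σ`-norm one**: if `u·1 ∈ U(Φ₃)(L⁺_v)` then `σ(u) u = 1`, i.e. `u ∈ E¹_v` (the torus relation of ★ `glDiagonal_mem_unitaryGroupOfForm_antidiagonal_iff`
at the constant diagonal). [cite: Mok2014, §1 Notation p. 5] [cite: Rogawski1990, §1.9 p. 8] -/
theorem mem_normOneUnits_of_scalar_mem (u : (LocalRing L v)ˣ)
    (hu : Matrix.GeneralLinearGroup.scalar (Fin 3) u ∈ unitaryGroupOfForm (conjLocal L (IsCMField.complexConj L) v) (cmLocalForm L 3 v)) :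
    u ∈ normOneUnits (conjLocal L (IsCMField.complexConj L) v) := by
  have hsc : Matrix.GeneralLinearGroup.scalar (Fin 3) u = glDiagonal 3 (LocalRing L v) (fun _ => u) := by
    refine Units.ext ?_
    rw [Matrix.GeneralLinearGroup.coe_scalar, coe_glDiagonal, Matrix.scalar_apply]
  rw [hsc, cmLocalForm_eq_over L 3 v, glDiagonal_mem_unitaryGroupOfForm_antidiagonal_iff] at hu
  exact (UnitaryGroup.mem_normOneUnits_iff _).2 (hu 0)

/-- A hom `ι : E¹_v →* Z(G)` with `ι z = z·1` is surjective at a non-split `v`: the centre of `U(Φ₃)(L⁺_v)` is scalar (★ `forall_mem_center_cmLocal_eq_scalar`) and a unitary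
scalar lies in `E¹_v`. [cite: Rogawski1990, §4.9 p. 54] [cite: Mok2014, §1 Notation p. 5] -/
theorem surjective_of_pin (hns : ∀ w : PlacesOver L v, IsCMField.complexConj L • w.1 = w.1)
    (ι : ↥(normOneUnits (conjLocal L (IsCMField.complexConj L) v)) →* ↥(Subgroup.center (Gqs L v)))
    (hι : ∀ z : ↥(normOneUnits (conjLocal L (IsCMField.complexConj L) v)),
      ((ι z).val.val.val : Matrix (Fin 3) (Fin 3) (LocalRing L v)) = (((z : (LocalRing L v)ˣ) : LocalRing L v)) • (1 : Matrix (Fin 3) (Fin 3) (LocalRing L v))) :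
    Function.Surjective ι := by
  intro c
  obtain ⟨u, hu⟩ := forall_mem_center_cmLocal_eq_scalar L (qsForm L) (antidiagOne_isHermitian L 3) (isUnit_antidiagOne_det L 3) v hns c.val c.2
  have hmem : Matrix.GeneralLinearGroup.scalar (Fin 3) u ∈ unitaryGroupOfForm (conjLocal L (IsCMField.complexConj L) v) (cmLocalForm L 3 v) := by
    rw [← hu]
    exact c.val.2
  refine ⟨⟨u, mem_normOneUnits_of_scalar_mem L v u hmem⟩, Subtype.ext (Subtype.ext (Units.ext ?_))⟩
  rw [hι, hu, Matrix.GeneralLinearGroup.coe_scalar, Matrix.scalar_apply, Matrix.smul_one_eq_diagonal]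

/-- **«ST-JH★» inversion.**  For a continuous `ι : E¹_v →* Z(U(Φ₃)(L⁺_v))` with `ι z = z·1` (the pin clause of ★ `exists_stDetFields`) at a non-split `v`, every continuous
character `ψ₀` of `E¹_v` is `ψ ∘ ι` for a continuous character `ψ` of the centre: `ι` is a continuous bijection from the COMPACT `E¹_v` (★ `compactSpace_normOneUnits`)
onto the Hausdorff `Z(G)`, hence a homeomorphism, and `ψ := ψ₀ ∘ ι⁻¹`. [cite: Rogawski1990, §4.9 p. 54; §12.2 (1) p. 172] [cite: PlatonovRapinchuk1994, §5.1] -/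
theorem exists_centerChar_comp_eq (hns : ∀ w : PlacesOver L v, IsCMField.complexConj L • w.1 = w.1)
    (ι : ↥(normOneUnits (conjLocal L (IsCMField.complexConj L) v)) →* ↥(Subgroup.center (Gqs L v))) (hιc : Continuous ι)
    (hι : ∀ z : ↥(normOneUnits (conjLocal L (IsCMField.complexConj L) v)),
      ((ι z).val.val.val : Matrix (Fin 3) (Fin 3) (LocalRing L v)) = (((z : (LocalRing L v)ˣ) : LocalRing L v)) • (1 : Matrix (Fin 3) (Fin 3) (LocalRing L v)))
    (ψ₀ : ↥(normOneUnits (conjLocal L (IsCMField.complexConj L) v)) →* ℂˣ) (hψ₀ : Continuous ψ₀) :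
    ∃ ψ : ↥(Subgroup.center (Gqs L v)) →* ℂˣ, Continuous ψ ∧ ψ.comp ι = ψ₀ := by
  haveI : CompactSpace ↥(normOneUnits (conjLocal L (IsCMField.complexConj L) v)) := F0P3cStCharTSTorusCompactPart.compactSpace_normOneUnits L v hns
  have hbij : Function.Bijective ι := ⟨injective_of_pin L v ι hι, surjective_of_pin L v hns ι hι⟩
  let e : ↥(normOneUnits (conjLocal L (IsCMField.complexConj L) v)) ≃* ↥(Subgroup.center (Gqs L v)) := MulEquiv.ofBijective ι hbij
  have hesymm : Continuous e.symm := by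
    have h := Continuous.continuous_symm_of_equiv_compact_to_t2 (f := Equiv.ofBijective ι hbij) hιc
    exact h
  refine ⟨ψ₀.comp e.symm.toMonoidHom, hψ₀.comp hesymm, ?_⟩
  ext z
  change ((ψ₀ (e.symm (e z)) : ℂˣ) : ℂ) = _
  rw [e.symm_apply_apply]

/-- Uniqueness in «ST-JH★»: `ψ ∘ ι` determines `ψ` (`ι` is onto the centre). [cite: Rogawski1990, §4.9 p. 54] -/
theorem centerChar_comp_eq_unique (hns : ∀ w : PlacesOver L v, IsCMField.complexConj L • w.1 = w.1)
    (ι : ↥(normOneUnits (conjLocal L (IsCMField.complexConj L) v)) →* ↥(Subgroup.center (Gqs L v)))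
    (hι : ∀ z : ↥(normOneUnits (conjLocal L (IsCMField.complexConj L) v)),
      ((ι z).val.val.val : Matrix (Fin 3) (Fin 3) (LocalRing L v)) = (((z : (LocalRing L v)ˣ) : LocalRing L v)) • (1 : Matrix (Fin 3) (Fin 3) (LocalRing L v)))
    {ψ ψ' : ↥(Subgroup.center (Gqs L v)) →* ℂˣ} (h : ψ.comp ι = ψ'.comp ι) : ψ = ψ' := by
  refine MonoidHom.ext fun c => ?_
  obtain ⟨z, rfl⟩ := surjective_of_pin L v hns ι hι c
  exact DFunLike.congr_fun h z

/-- Continuity of an `ℂˣ`-valued hom from continuity of its `ℂ`-value (the currency `Continuous fun x => ((ψ₀ x : ℂˣ) : ℂ)` of ★ B4 `stLabels`). [folklore] -/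
theorem continuous_of_continuous_val {M : Type} [TopologicalSpace M] (ψ₀ : M → ℂˣ) (h : Continuous fun x => ((ψ₀ x : ℂˣ) : ℂ)) : Continuous ψ₀ := by
  refine Units.continuous_iff.2 ⟨h, ?_⟩
  simp only [Units.val_inv_eq_inv_val]
  exact h.inv₀ fun x => (ψ₀ x).ne_zero

/-! ## §2 The Jordan–Hölder clause of «ST-PIN★» read at `ψ₀ ∈ Hom(E¹_v, ℂ^*)` -/

set_option maxHeartbeats 400000 in
/-- **«ST-JH★» (hypothesis form over the fields of ★ `exists_stDetFields`).**  If `(ι, stG, detG)` satisfy the pin clause and the JH clause of ★ E — for every continuous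
`ψ : Z(G) →* ℂˣ`, `JH(i_G(χ_St(ψ∘ι))) = {stG ψ, detG ψ}` — then for every character `ψ₀` of `E¹_v` with continuous `ℂ`-value there is a continuous `ψ` with `ψ ∘ ι = ψ₀` and
`JH(i_G(χ_St(ψ₀))) = {stG ψ, detG ψ}`: case (1) of [§12.2] read at `ψ₀`. [cite: Rogawski1990, §12.2 (1) pp. 172–173; §4.9 p. 54] [cite: Keys1984, §7 Theorem] -/
theorem stJH_of_fields (hns : ∀ w : PlacesOver L v, IsCMField.complexConj L • w.1 = w.1)
    (ι : ↥(normOneUnits (conjLocal L (IsCMField.complexConj L) v)) →* ↥(Subgroup.center (Gqs L v))) (hιc : Continuous ι)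
    (hι : ∀ z : ↥(normOneUnits (conjLocal L (IsCMField.complexConj L) v)),
      ((ι z).val.val.val : Matrix (Fin 3) (Fin 3) (LocalRing L v)) = (((z : (LocalRing L v)ˣ) : LocalRing L v)) • (1 : Matrix (Fin 3) (Fin 3) (LocalRing L v)))
    (stG detG : (↥(Subgroup.center (Gqs L v)) →* ℂˣ) → IrrClass (Gqs L v))
    (hJH : ∀ ψ : ↥(Subgroup.center (Gqs L v)) →* ℂˣ, Continuous ψ → ∀ c : IrrClass (Gqs L v),
      c.IsConstituentOf (cmPrincipalSeries L 3 v
        (cmTorusCharPair L v (halfModulusChar (LocalRing L v) * halfModulusChar (LocalRing L v))⁻¹ (ψ.comp ι))) ↔ (c = stG ψ ∨ c = detG ψ))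
    (ψ₀ : ↥(normOneUnits (conjLocal L (IsCMField.complexConj L) v)) →* ℂˣ) (hψ₀ : Continuous fun x => ((ψ₀ x : ℂˣ) : ℂ)) :
    ∃ ψ : ↥(Subgroup.center (Gqs L v)) →* ℂˣ, Continuous ψ ∧ ψ.comp ι = ψ₀ ∧
      ∀ c : IrrClass (Gqs L v),
        c.IsConstituentOf (cmPrincipalSeries L 3 v
          (cmTorusCharPair L v (halfModulusChar (LocalRing L v) * halfModulusChar (LocalRing L v))⁻¹ ψ₀)) ↔ (c = stG ψ ∨ c = detG ψ) := by
  obtain ⟨ψ, hψc, hcomp⟩ := exists_centerChar_comp_eq L v hns ι hιc hι ψ₀ (continuous_of_continuous_val ψ₀ hψ₀)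
  subst hcomp
  exact ⟨ψ, hψc, rfl, hJH ψ hψc⟩

set_option maxHeartbeats 400000 in
/-- **«ST-JH★», `w`-twin**: the same with the principal series `i_G(w·χ_St(ψ₀))` (first component `conjInvChar`-twisted), which has the same constituents (★ K1w
`isConstituentOf_iff_weyl`). [cite: Rogawski1990, §12.1 p. 172; §12.2 (1) pp. 172–173] [cite: Keys1984, §7 Theorem] -/
theorem stJH_weyl_of_fields (hns : ∀ w : PlacesOver L v, IsCMField.complexConj L • w.1 = w.1)
    (ι : ↥(normOneUnits (conjLocal L (IsCMField.complexConj L) v)) →* ↥(Subgroup.center (Gqs L v))) (hιc : Continuous ι)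
    (hι : ∀ z : ↥(normOneUnits (conjLocal L (IsCMField.complexConj L) v)),
      ((ι z).val.val.val : Matrix (Fin 3) (Fin 3) (LocalRing L v)) = (((z : (LocalRing L v)ˣ) : LocalRing L v)) • (1 : Matrix (Fin 3) (Fin 3) (LocalRing L v)))
    (stG detG : (↥(Subgroup.center (Gqs L v)) →* ℂˣ) → IrrClass (Gqs L v))
    (hJH : ∀ ψ : ↥(Subgroup.center (Gqs L v)) →* ℂˣ, Continuous ψ → ∀ c : IrrClass (Gqs L v),
      c.IsConstituentOf (cmPrincipalSeries L 3 v
        (cmTorusCharPair L v (halfModulusChar (LocalRing L v) * halfModulusChar (LocalRing L v))⁻¹ (ψ.comp ι))) ↔ (c = stG ψ ∨ c = detG ψ))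
    (ψ₀ : ↥(normOneUnits (conjLocal L (IsCMField.complexConj L) v)) →* ℂˣ) (hψ₀ : Continuous fun x => ((ψ₀ x : ℂˣ) : ℂ)) :
    ∃ ψ : ↥(Subgroup.center (Gqs L v)) →* ℂˣ, Continuous ψ ∧ ψ.comp ι = ψ₀ ∧
      ∀ c : IrrClass (Gqs L v),
        c.IsConstituentOf (cmPrincipalSeries L 3 v
          (cmTorusCharPair L v (conjInvChar (conjLocal L (IsCMField.complexConj L) v)
            (halfModulusChar (LocalRing L v) * halfModulusChar (LocalRing L v))⁻¹) ψ₀)) ↔ (c = stG ψ ∨ c = detG ψ) := by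
  obtain ⟨ψ, hψc, hcomp, hjh⟩ := stJH_of_fields L v hns ι hιc hι stG detG hJH ψ₀ hψ₀
  exact ⟨ψ, hψc, hcomp, fun c =>
    (F0P3cStCharTSPs2Kind3.isConstituentOf_iff_weyl L v hns (halfModulusChar (LocalRing L v) * halfModulusChar (LocalRing L v))⁻¹ ψ₀ c).symm.trans (hjh c)⟩

/-! ## §3 The packaged edition: ★ «ST-PIN★» `exists_stDetFields` with the inversion conjunct -/

set_option synthInstance.maxHeartbeats 400000 in
set_option maxHeartbeats 8000000 in  -- destructuring ∕ re-packing the 12-conjunct existential of ★ E (same class as ★ E itself, 16M there)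
/-- **«ST-PIN★» + «ST-JH★» in one existential**: the statement of ★ `F0P3cStCharTSStPin.exists_stDetFields` verbatim (continuous `ι`, `det_Z`, the pin clauses, the
per-`ψ` LABEL ∕ JH ∕ (ST-L2)-(DET) clauses, and (ST-L2), `DetNotL2` at every datum built on the fields) WITH ONE CONJUNCT ADDED before the datum clause: every continuous
character `ψ₀` of `E¹_v` is `ψ ∘ ι` for a continuous `ψ : Z(G) →* ℂˣ` (`exists_centerChar_comp_eq`) — so the JH clause reads at `i_G(χ_St(ψ₀))` for every `ψ₀`
(`stJH_of_fields`). [cite: Rogawski1990, §4.9 p. 54; §12.1 p. 172; §12.2 (1) pp. 172–173; §12.6 Prop. 12.6.1 (b) p. 188] [cite: Keys1984, §7 Theorem]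
[cite: Casselman1995, Thm 4.4.6] -/
theorem exists_stDetFields_jh (hns : ∀ w : PlacesOver L v, IsCMField.complexConj L • w.1 = w.1)
    [MeasurableSpace (Gqs L v ⧸ Subgroup.center (Gqs L v))] [BorelSpace (Gqs L v ⧸ Subgroup.center (Gqs L v))]
    (μZ : Measure (Gqs L v ⧸ Subgroup.center (Gqs L v))) [μZ.IsHaarMeasure] :
    ∃ (ι : ↥(normOneUnits (conjLocal L (IsCMField.complexConj L) v)) →* ↥(Subgroup.center (Gqs L v)))
      (detZ : Gqs L v →* ↥(Subgroup.center (Gqs L v)))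
      (detG stG : (↥(Subgroup.center (Gqs L v)) →* ℂˣ) → IrrClass (Gqs L v)),
      Continuous ι ∧ Continuous detZ ∧
      (∀ z : ↥(normOneUnits (conjLocal L (IsCMField.complexConj L) v)),
        ((ι z).val.val.val : Matrix (Fin 3) (Fin 3) (LocalRing L v)) = (((z : (LocalRing L v)ˣ) : LocalRing L v)) • (1 : Matrix (Fin 3) (Fin 3) (LocalRing L v))) ∧
      (∀ g : Gqs L v, ((detZ g).val.val.val : Matrix (Fin 3) (Fin 3) (LocalRing L v)) =
        (g.val.val : Matrix (Fin 3) (Fin 3) (LocalRing L v)).det • (1 : Matrix (Fin 3) (Fin 3) (LocalRing L v))) ∧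
      (∀ ψ : ↥(Subgroup.center (Gqs L v)) →* ℂˣ, Continuous ψ →
        (∃ hopen : IsOpen (((ψ.comp detZ).ker : Subgroup (Gqs L v)) : Set (Gqs L v)),
          detG ψ = IrrClass.mk (SmoothIrrep.ofChar (ψ.comp detZ) hopen)) ∧
        stG ψ ≠ detG ψ ∧
        (∀ c : IrrClass (Gqs L v),
          c.IsConstituentOf (cmPrincipalSeries L 3 v
            (cmTorusCharPair L v (halfModulusChar (LocalRing L v) * halfModulusChar (LocalRing L v))⁻¹ (ψ.comp ι))) ↔ (c = stG ψ ∨ c = detG ψ)) ∧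
        (stG ψ).IsSquareIntegrable μZ ∧ ¬ (detG ψ).IsSquareIntegrable μZ ∧
        (haveI := locallyCompactSpace_cmBorelU L 3 v
         ∃ r : SmoothIrrep (Gqs L v), IrrClass.mk r = detG ψ ∧
          Nonempty ((r.ρ.normalizedJacquet (cmBorelTriple L 3 v)).Equiv
            ((Representation.trivial ℂ ↥(torusU (conjLocal L (IsCMField.complexConj L) v) (cmLocalForm L 3 v)) ℂ).twist
              (cmTorusCharPair L v (halfModulusChar (LocalRing L v) * halfModulusChar (LocalRing L v))⁻¹ (ψ.comp ι))))) ∧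
        (haveI := locallyCompactSpace_cmBorelU L 3 v
         ∃ r : SmoothIrrep (Gqs L v), IrrClass.mk r = stG ψ ∧
          Nonempty ((r.ρ.normalizedJacquet (cmBorelTriple L 3 v)).Equiv
            ((Representation.trivial ℂ ↥(torusU (conjLocal L (IsCMField.complexConj L) v) (cmLocalForm L 3 v)) ℂ).twist
              (cmWeylTorusCharPair L v (halfModulusChar (LocalRing L v) * halfModulusChar (LocalRing L v))⁻¹ (ψ.comp ι)))))) ∧
      (∀ ψ₀ : ↥(normOneUnits (conjLocal L (IsCMField.complexConj L) v)) →* ℂˣ, Continuous ψ₀ →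
        ∃ ψ : ↥(Subgroup.center (Gqs L v)) →* ℂˣ, Continuous ψ ∧ ψ.comp ι = ψ₀) ∧
      (∀ {H' : Type} [Group H'] [TopologicalSpace H'] [IsTopologicalGroup H'] [MeasurableSpace H']
        [MeasurableSpace (Gqs L v)] [∀ γ : Gqs L v, MeasurableSpace (Gqs L v ⧸ Subgroup.centralizer ({γ} : Set (Gqs L v)))]
        (𝔇 : EllipticData (Gqs L v) H'), 𝔇.stG = stG → 𝔇.detG = detG → 𝔇.μGZ = μZ →
          (∀ ψ : ↥(Subgroup.center (Gqs L v)) →* ℂˣ, Continuous ψ → 𝔇.IsL2 (𝔇.stG ψ)) ∧ 𝔇.DetNotL2) := by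
  obtain ⟨ι, detZ, detG, stG, hιc, hdc, hι, hdetZ, hψ, h𝔇⟩ := F0P3cStCharTSStPin.exists_stDetFields L v hns μZ
  exact ⟨ι, detZ, detG, stG, hιc, hdc, hι, hdetZ, hψ, fun ψ₀ hψ₀ => exists_centerChar_comp_eq L v hns ι hιc hι ψ₀ hψ₀, h𝔇⟩

/-! ## §4 (ED. 2) «ST-JH★» AT A DATUM — the junction's `hStJH` binder, token for token -/

set_option maxHeartbeats 400000 in
/-- **«ST-JH★» AT A §12.5 DATUM.**  For fields `(ι, stG, detG)` as in ★ E (pin clause `hι`, JH clause `hJH`) and ANY datum `𝔇` on `(U(Φ₃)(L⁺_v), H)` whose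
Steinberg ∕ determinant fields ARE these (`𝔇.stG = stG`, `𝔇.detG = detG` — `rfl` at the RUNG-0 witness), the junction hypothesis `hStJH` of ★ «RED-JH ⟸ KEYS-RED»
`F0P3cStCharTSRedJH.redJH_of_keysRed` holds TOKEN FOR TOKEN: for every `ψ₀ ∈ Hom(E¹_v, ℂ^*)` with continuous value there is a continuous `ψ : Z(G) →* ℂˣ` with
`JH(i_G(χ_St(ψ₀))) = {𝔇.stG ψ, 𝔇.detG ψ}`. [cite: Rogawski1990, §12.2 (1) pp. 172–173; §4.9 p. 54] [cite: Keys1984, §7 Theorem] -/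
theorem stJH_datum (hns : ∀ w : PlacesOver L v, IsCMField.complexConj L • w.1 = w.1)
    (ι : ↥(normOneUnits (conjLocal L (IsCMField.complexConj L) v)) →* ↥(Subgroup.center (Gqs L v))) (hιc : Continuous ι)
    (hι : ∀ z : ↥(normOneUnits (conjLocal L (IsCMField.complexConj L) v)),
      ((ι z).val.val.val : Matrix (Fin 3) (Fin 3) (LocalRing L v)) = (((z : (LocalRing L v)ˣ) : LocalRing L v)) • (1 : Matrix (Fin 3) (Fin 3) (LocalRing L v)))
    (stG detG : (↥(Subgroup.center (Gqs L v)) →* ℂˣ) → IrrClass (Gqs L v))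
    (hJH : ∀ ψ : ↥(Subgroup.center (Gqs L v)) →* ℂˣ, Continuous ψ → ∀ c : IrrClass (Gqs L v),
      c.IsConstituentOf (cmPrincipalSeries L 3 v
        (cmTorusCharPair L v (halfModulusChar (LocalRing L v) * halfModulusChar (LocalRing L v))⁻¹ (ψ.comp ι))) ↔ (c = stG ψ ∨ c = detG ψ))
    [MeasurableSpace (Gqs L v)] [∀ γ : Gqs L v, MeasurableSpace (Gqs L v ⧸ Subgroup.centralizer ({γ} : Set (Gqs L v)))]
    [MeasurableSpace (Gqs L v ⧸ Subgroup.center (Gqs L v))]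
    {H : Type} [Group H] [TopologicalSpace H] [IsTopologicalGroup H] [MeasurableSpace H]
    (𝔇 : EllipticData (Gqs L v) H) (hst : 𝔇.stG = stG) (hdet : 𝔇.detG = detG) :
    ∀ ψ₀ : ↥(normOneUnits (conjLocal L (IsCMField.complexConj L) v)) →* ℂˣ, Continuous (fun x => ((ψ₀ x : ℂˣ) : ℂ)) →
      ∃ ψ : ↥(Subgroup.center (Gqs L v)) →* ℂˣ, Continuous ψ ∧
        ∀ c : IrrClass (Gqs L v),
          c.IsConstituentOf (cmPrincipalSeries L 3 v
            (cmTorusCharPair L v (halfModulusChar (LocalRing L v) * halfModulusChar (LocalRing L v))⁻¹ ψ₀)) ↔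
            (c = 𝔇.stG ψ ∨ c = 𝔇.detG ψ) := by
  subst hst hdet
  intro ψ₀ hψ₀
  obtain ⟨ψ, hψc, -, hjh⟩ := stJH_of_fields L v hns ι hιc hι 𝔇.stG 𝔇.detG hJH ψ₀ hψ₀
  exact ⟨ψ, hψc, hjh⟩

set_option maxHeartbeats 400000 in
/-- **«ST-JH★» AT A §12.5 DATUM, `w`-twin** (`i_G(w·χ_St(ψ₀))`, same constituents by ★ K1w). [cite: Rogawski1990, §12.1 p. 172; §12.2 (1) pp. 172–173] -/
theorem stJH_weyl_datum (hns : ∀ w : PlacesOver L v, IsCMField.complexConj L • w.1 = w.1)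
    (ι : ↥(normOneUnits (conjLocal L (IsCMField.complexConj L) v)) →* ↥(Subgroup.center (Gqs L v))) (hιc : Continuous ι)
    (hι : ∀ z : ↥(normOneUnits (conjLocal L (IsCMField.complexConj L) v)),
      ((ι z).val.val.val : Matrix (Fin 3) (Fin 3) (LocalRing L v)) = (((z : (LocalRing L v)ˣ) : LocalRing L v)) • (1 : Matrix (Fin 3) (Fin 3) (LocalRing L v)))
    (stG detG : (↥(Subgroup.center (Gqs L v)) →* ℂˣ) → IrrClass (Gqs L v))
    (hJH : ∀ ψ : ↥(Subgroup.center (Gqs L v)) →* ℂˣ, Continuous ψ → ∀ c : IrrClass (Gqs L v),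
      c.IsConstituentOf (cmPrincipalSeries L 3 v
        (cmTorusCharPair L v (halfModulusChar (LocalRing L v) * halfModulusChar (LocalRing L v))⁻¹ (ψ.comp ι))) ↔ (c = stG ψ ∨ c = detG ψ))
    [MeasurableSpace (Gqs L v)] [∀ γ : Gqs L v, MeasurableSpace (Gqs L v ⧸ Subgroup.centralizer ({γ} : Set (Gqs L v)))]
    [MeasurableSpace (Gqs L v ⧸ Subgroup.center (Gqs L v))]
    {H : Type} [Group H] [TopologicalSpace H] [IsTopologicalGroup H] [MeasurableSpace H]
    (𝔇 : EllipticData (Gqs L v) H) (hst : 𝔇.stG = stG) (hdet : 𝔇.detG = detG) :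
    ∀ ψ₀ : ↥(normOneUnits (conjLocal L (IsCMField.complexConj L) v)) →* ℂˣ, Continuous (fun x => ((ψ₀ x : ℂˣ) : ℂ)) →
      ∃ ψ : ↥(Subgroup.center (Gqs L v)) →* ℂˣ, Continuous ψ ∧
        ∀ c : IrrClass (Gqs L v),
          c.IsConstituentOf (cmPrincipalSeries L 3 v
            (cmTorusCharPair L v (conjInvChar (conjLocal L (IsCMField.complexConj L) v)
              (halfModulusChar (LocalRing L v) * halfModulusChar (LocalRing L v))⁻¹) ψ₀)) ↔
            (c = 𝔇.stG ψ ∨ c = 𝔇.detG ψ) := by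
  subst hst hdet
  intro ψ₀ hψ₀
  obtain ⟨ψ, hψc, -, hjh⟩ := stJH_weyl_of_fields L v hns ι hιc hι 𝔇.stG 𝔇.detG hJH ψ₀ hψ₀
  exact ⟨ψ, hψc, hjh⟩

end Summit.HodgeConjecture.HodgeConjecture.Cruxes.H413.F0P3cStCharTSStJH

end
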